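import Summits.CriticalPhenomena.PercolationContinuityZ3.Theorems.PercNearOneGluingNoHeavyQuantFarSunCertNineTwoB
import HarnessLib

/-!
# FAR beyond trees: **`HairyCycle.SunFAR 9 2`** — the exact configuration-level two-copy certificate for the sun graph with `K = 9` hairs at layer `j = 2` (Kronecker-checked, 3 shard files) — shard file 3/3 (`l ∈ {9,10}`)

builds on p205010 (kernel theorem, internal audit signed; external expert review pending)

Support file (`--supports stmt-CriticalPhenomena-4575`), seat `prim-cert-1` (gen 26); memo `prim-cert-1/FROM-prim-cert-1-g26-CONFIG-CERTS.md`.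
Shard 3 of 3 of the Kronecker check of the `(9,2)` certificate (`PercNearOneGluingNoHeavyQuantFarSunCertNineTwo`): prefix lengths `l ∈ {9, 10}`
(1155 blocks; each shard file stays under the farm's elaboration budget).  COMPUTATIONAL (`native_decide`).  Assembles **`HairyCycle.sunFAR_nine_two : SunFAR 9 2`**.
[cite: KozmaNitzan2024, Lemma 2 (p. 6), Conjecture 3 (p. 15)] (context: the lower-tail family; FAR is this programme's statement).
-/

namespace Summit.CriticalPhenomena.PercolationContinuityZ3.Theorems.HairyCycle

namespace TK


/-- Core-inequality check of the `(9, 2)` certificate, shard `l ∈ {9, 10}` (1155 blocks), base `2^66` (computational;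
one `native_decide`, so the record banks are built once). [this work] -/
theorem cK92_s3 : ([9, 10].all fun l => kronL 9 66 (mkBanks 9 2 66 (mkNTabs 9 am92 bm92)) l) = true := by
  native_decide

end TK

/-- **FAR at layer `2` on the sun graph with `9` hairs, all weights: `SunFAR 9 2`** (exact typed configuration-level two-copy certificate, kit j168802, Kronecker-checked in three shard files). [this work] -/
theorem sunFAR_nine_two : SunFAR 9 2 := by
  refine TK.sunFAR_of_kronL (s := 66) (by norm_num) TK.am92 TK.bm92 TK.cN92 fun l hl => ?_
  have h1 := List.all_eq_true.1 TK.cK92_s1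
  have h2 := List.all_eq_true.1 TK.cK92_s2
  have h3 := List.all_eq_true.1 TK.cK92_s3
  interval_cases l
  · exact h1 0 (by simp)
  · exact h1 1 (by simp)
  · exact h1 2 (by simp)
  · exact h1 3 (by simp)
  · exact h1 4 (by simp)
  · exact h1 5 (by simp)
  · exact h2 6 (by simp)
  · exact h2 7 (by simp)
  · exact h2 8 (by simp)
  · exact h3 9 (by simp)
  · exact h3 10 (by simp)

end Summit.CriticalPhenomena.PercolationContinuityZ3.Theorems.HairyCycle
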